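import Literature.Probability.LatticeModels.IsingLaceCoefficients
import Literature.Probability.LatticeModels.CurrentClusters
import HarnessLib

/-!
# Decoupling across the cluster `𝒞^b(v)` with a bond removed, for one current and for pairs

Topic `Probability/LatticeModels`, grouping namespaces `Current` (generic current lemmas) and
`IsingLace` (continuation of `IsingLaceCoefficients.lean`; companion of `IsingLaceConditioning.lean`,
which carries out the first-stage conditioning (2.14)–(2.16) at a FROZEN cluster by the splice
transfer of `WeightedClusterDecomposition.lean` — here instead the un-frozen, bijective
decomposition of the whole sum, in the form needed for PAIRS of currents in the second stage).
In both stages of Sakai's lace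
expansion (Sakai 2007, §2.2.1 (2.14) and §2.2.2 (2.32)–(2.33)) one "conditions on
`𝒞^b_{m+n}(v) = ℬ` and decouples events occurring on `𝔹_{ℬᶜ}` from events occurring on
`𝔹_Λ ∖ 𝔹_{ℬᶜ}`", splitting each current as `n = n' + n''` with `n' = n|_{𝔹_Λ ∖ 𝔹_{ℬᶜ}}` (the bonds
MEETING `ℬ`, among them the removed bond `b` when it is a boundary bond of the cluster) and
`n'' = n|_{𝔹_{ℬᶜ}}` (the bonds OFF `ℬ`), the weights factorising as `w_Λ(n) = w̃_{Λ,ℬ}(n') w_{ℬᶜ}(n'')`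
((2.13)). Here `𝒞^b_N(v)` is the cluster of `v` in `N` with the bond `b` deleted
(`IsingLace.clusterOff`), so — unlike the plain cluster of `CurrentClusters.lean`
(`Current.tsum_pair_eq_sum_cluster`, Tasaki–Hara's Lemma A.19) — the bond `b` itself may carry
current across the boundary of `ℬ`, which is why the inside part lives on the bonds meeting `ℬ`
rather than on the bonds inside `ℬ`.

PROVED here (uniform coupling `β ≥ 0`, all sums in `ℝ≥0∞`):

* `Current.IsTouchSupp S n` — `n` lives on the bonds meeting `S` (`n|_{𝔹_{Sᶜ}} ≡ 0`); the
  splitting `n = spliceOff S n 0 + spliceOff S 0 n` into a part meeting `S` and a part off `S`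
  (`Current.spliceOff` of `WeightedCurrents.lean`), its uniqueness, and the factorisation of the
  weights (`Current.weight_add_of_isTouchSupp`);
* the cluster facts: restricting `N` to the bonds meeting `𝒞^b_N(v)` does not change `𝒞^b_N(v)`,
  and adding currents off `𝒞^b_N(v)` does not change it (`IsingLace.clusterOff_spliceOff_eq`,
  `IsingLace.clusterOff_add_eq_of_isSupp`);
* **the decoupling identity across `𝒞^b(v)`**, for one current (`IsingLace.tsum_eq_sum_clusterOff`,
  the first stage (2.14)) and for pairs (`IsingLace.tsum_pair_eq_sum_clusterOff`, the second
  stage (2.32)–(2.33)):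
  for every bond `b`, vertex `v` and `Φ ≥ 0`,
  `Σ_{(m,n)} w(m)w(n) Φ(m,n) = Σ_ℬ Σ_{(m',n'),(m'',n'')} 1{m',n' meet ℬ, 𝒞^b_{m'+n'}(v) = ℬ}
     1{m'',n'' ⊆ 𝔹_{ℬᶜ}} w(m')w(n')w(m'')w(n'') Φ(m'+m'', n'+n'')`,
  the map `((m',n'),(m'',n'')) ↦ (m'+m'', n'+n'')` being a weight-preserving bijection onto
  `{𝒞^b_{m+n}(v) = ℬ}`.

The source constraints, parities and indicators of (2.14)/(2.32) are then distributed over the two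
factors by the user ((2.33)); nothing specific to them is assumed here.

## References

* A. Sakai, *Lace expansion for the Ising model*, Comm. Math. Phys. 272 (2007) 283–344,
  arXiv:math-ph/0510093: §2.2.1 ((2.13)–(2.14)), §2.2.2 ((2.32)–(2.33)) [Sakai2007].
* H. Tasaki, T. Hara, *Mathematical theory of phase transitions and critical phenomena*
  (Kyoritsu, 2015), App. A, Lemma A.19 (the same mechanism for the plain cluster) [TasakiHara2015].
-/

noncomputable section

open Finset
open scoped symmDiff ENNReal BigOperators

namespace Literature.Probability.LatticeModels

variable {V : Type*} [Fintype V] [DecidableEq V] {G : SimpleGraph V} [DecidableRel G.Adj]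

namespace Current

/-! ## Currents on the bonds meeting a vertex set -/

/-- `n` lives on the bonds MEETING `S` (Sakai's `𝔹_Λ ∖ 𝔹_{Sᶜ}`): it vanishes on every bond off `S`.
[cite: Sakai2007, (2.13) (k ∈ ℤ₊^{𝔹_Λ ∖ 𝔹_{𝒜ᶜ}})] -/
def IsTouchSupp (S : Finset V) (n : Current G) : Prop :=
  ∀ e : G.edgeFinset, EdgeOff S (e : Sym2 V) → n e = 0

/-- `IsTouchSupp` is decidable. [folklore] -/
instance instDecidableIsTouchSupp (S : Finset V) (n : Current G) : Decidable (IsTouchSupp S n) := by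
  unfold IsTouchSupp; infer_instance

/-- The part of `n` on the bonds meeting `S` lives there. [folklore] -/
theorem isTouchSupp_spliceOff_zero (S : Finset V) (n : Current G) : IsTouchSupp S (spliceOff S n 0) :=
  fun _ he => spliceOff_apply_of_edgeOff n 0 he

/-- The part of `n` on the bonds off `S` lives on `offGraph G S`. [folklore] -/
theorem isSupp_offGraph_zero_spliceOff (S : Finset V) (n : Current G) :
    IsSupp (offGraph G S) (spliceOff S 0 n) :=
  isSupp_offGraph_iff.2 fun _ he => spliceOff_apply_of_not_edgeOff 0 n he

/-- **The splitting `n = n' + n''`** into the part meeting `S` and the part off `S`.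
[cite: Sakai2007, (2.13)–(2.14) (n = k + m)] -/
theorem spliceOff_zero_add_zero_spliceOff (S : Finset V) (n : Current G) :
    spliceOff S n 0 + spliceOff S 0 n = n := by
  funext e
  by_cases he : EdgeOff S (e : Sym2 V) <;> simp [spliceOff, he]

/-- Splicing is additive in both arguments. [folklore] -/
theorem spliceOff_add_add (S : Finset V) (a b c d : Current G) :
    spliceOff S (a + b) (c + d) = spliceOff S a c + spliceOff S b d := by
  funext e
  by_cases he : EdgeOff S (e : Sym2 V) <;> simp [spliceOff, he]

/-- On every bond one of a current meeting `S` and a current off `S` vanishes. [folklore] -/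
theorem apply_eq_zero_or_of_isTouchSupp {S : Finset V} {a k : Current G} (ha : IsTouchSupp S a)
    (hk : IsSupp (offGraph G S) k) (e : G.edgeFinset) : a e = 0 ∨ k e = 0 := by
  by_cases he : EdgeOff S (e : Sym2 V)
  · exact Or.inl (ha e he)
  · exact Or.inr (isSupp_offGraph_iff.1 hk e he)

/-- **Uniqueness of the splitting**, first part: `(a + k)' = a`. [folklore] -/
theorem spliceOff_add_zero_of_isTouchSupp {S : Finset V} {a k : Current G} (ha : IsTouchSupp S a)
    (hk : IsSupp (offGraph G S) k) : spliceOff S (a + k) 0 = a := by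
  funext e
  by_cases he : EdgeOff S (e : Sym2 V)
  · rw [spliceOff_apply_of_edgeOff _ _ he, ha e he]; rfl
  · rw [spliceOff_apply_of_not_edgeOff _ _ he, Pi.add_apply, isSupp_offGraph_iff.1 hk e he, add_zero]

/-- **Uniqueness of the splitting**, second part: `(a + k)'' = k`. [folklore] -/
theorem zero_spliceOff_add_of_isTouchSupp {S : Finset V} {a k : Current G} (ha : IsTouchSupp S a)
    (hk : IsSupp (offGraph G S) k) : spliceOff S 0 (a + k) = k := by
  funext e
  by_cases he : EdgeOff S (e : Sym2 V)
  · rw [spliceOff_apply_of_edgeOff _ _ he, Pi.add_apply, ha e he, zero_add]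
  · rw [spliceOff_apply_of_not_edgeOff _ _ he, isSupp_offGraph_iff.1 hk e he]; rfl

/-- **The weights factorise**: `w(a + k) = w(a) w(k)` for `a` meeting `S` and `k` off `S`
(`w_Λ(n) = w̃_{Λ,𝒜}(k) w_{𝒜ᶜ}(m)`). [cite: Sakai2007, (2.13)–(2.14)] -/
theorem weight_add_of_isTouchSupp {S : Finset V} {a k : Current G} (ha : IsTouchSupp S a)
    (hk : IsSupp (offGraph G S) k) (β : ℝ) : (a + k).weight β = a.weight β * k.weight β := by
  unfold weight
  rw [← Finset.prod_mul_distrib]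
  refine Finset.prod_congr rfl fun e _ => ?_
  rcases apply_eq_zero_or_of_isTouchSupp ha hk e with h | h <;> simp [h]

omit [DecidableEq V] in
/-- Sums of currents meeting `S` meet `S`. [folklore] -/
theorem IsTouchSupp.add {S : Finset V} {a a' : Current G} (ha : IsTouchSupp S a) (ha' : IsTouchSupp S a') :
    IsTouchSupp S (a + a') := fun e he => by
  simp [Pi.add_apply, ha e he, ha' e he]

/-! ## Walks that cannot leave a vertex set -/

omit [Fintype V] [DecidableEq V] [DecidableRel G.Adj] in
/-- Transfer of reachability along an invariant: if from every vertex of `B` each `ω`-open step is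
`ω'`-open and stays in `B`, then `ω`-walks from `B` are `ω'`-reachabilities inside `B`. [folklore] -/
theorem reachable_of_forall_adj_imp {ω ω' : Percolation.BondConfig V} {B : Finset V}
    (h : ∀ u y, u ∈ B → (Percolation.openGraph ω).Adj u y → (Percolation.openGraph ω').Adj u y ∧ y ∈ B)
    {u w : V} (p : (Percolation.openGraph ω).Walk u w) (hu : u ∈ B) :
    (Percolation.openGraph ω').Reachable u w ∧ w ∈ B := by
  induction p with
  | nil => exact ⟨SimpleGraph.Reachable.refl _, hu⟩
  | @cons u y w huy p ih =>
    obtain ⟨hadj, hy⟩ := h u y hu huy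
    obtain ⟨hr, hw⟩ := ih hy
    exact ⟨hadj.reachable.trans hr, hw⟩

end Current

namespace IsingLace

/-! ## The cluster with a bond removed under restriction and extension -/

/-- Adjacency in the trace graph of `N` with `n_b` reset: a bond other than `b` carrying current.
[folklore] -/
theorem openGraph_traced_update_adj_iff (N : Current G) (b : G.edgeFinset) (u y : V) :
    (Percolation.openGraph (Current.traced (Function.update N b 0))).Adj u y ↔
      ∃ h : s(u, y) ∈ G.edgeFinset, (⟨s(u, y), h⟩ : G.edgeFinset) ≠ b ∧ 0 < N ⟨s(u, y), h⟩ := by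
  rw [Percolation.openGraph_adj]
  constructor
  · rintro ⟨⟨hG, hpos⟩, -⟩
    refine ⟨hG, fun heq => ?_, ?_⟩
    · rw [heq, Function.update_self] at hpos
      exact lt_irrefl 0 hpos
    · by_cases heq : (⟨s(u, y), hG⟩ : G.edgeFinset) = b
      · rw [heq, Function.update_self] at hpos
        exact absurd hpos (lt_irrefl 0)
      · rwa [Function.update_of_ne heq] at hpos
  · rintro ⟨hG, hne, hpos⟩
    refine ⟨⟨hG, ?_⟩, ?_⟩
    · rwa [Function.update_of_ne hne]
    · rintro rfl
      exact G.loopless.irrefl u (by simpa using (SimpleGraph.mem_edgeFinset).1 hG)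

/-- `v ∈ 𝒞^b_N(v)`. [cite: Sakai2007, Definition 2.1 (ii)] -/
theorem mem_clusterOff_self (N : Current G) (b : G.edgeFinset) (v : V) : v ∈ clusterOff G N b v :=
  Current.mem_cluster_self _ v

/-- `𝒞^b(v)` is closed under the bonds other than `b` carrying current. [cite: Sakai2007, Definition 2.1 (ii)] -/
theorem mem_clusterOff_of_adj {N : Current G} {b : G.edgeFinset} {v u y : V}
    (hu : u ∈ clusterOff G N b v)
    (hadj : (Percolation.openGraph (Current.traced (Function.update N b 0))).Adj u y) :
    y ∈ clusterOff G N b v := by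
  rw [clusterOff_eq, Current.mem_cluster_iff] at hu ⊢
  exact hu.trans hadj.reachable

/-- `𝒞^b` is monotone in the current. [folklore] -/
theorem clusterOff_mono {N N' : Current G} (h : N ≤ N') (b : G.edgeFinset) (v : V) :
    clusterOff G N b v ⊆ clusterOff G N' b v := by
  rw [clusterOff_eq, clusterOff_eq]
  refine Current.cluster_mono (fun e => ?_) v
  by_cases he : e = b
  · subst he; simp
  · rw [Function.update_of_ne he, Function.update_of_ne he]; exact h e

/-- **Adding currents off `𝒞^b_M(v)` does not change `𝒞^b(v)`**: no bond carrying the added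
current meets the cluster. [cite: Sakai2007, (2.14) and (2.32)–(2.33)] -/
theorem clusterOff_add_eq_of_isSupp {M k : Current G} {b : G.edgeFinset} {v : V} {B : Finset V}
    (hB : clusterOff G M b v = B) (hk : Current.IsSupp (offGraph G B) k) :
    clusterOff G (M + k) b v = B := by
  refine Finset.Subset.antisymm ?_ (hB ▸ clusterOff_mono le_self_add b v)
  intro w hw
  rw [clusterOff_eq, Current.mem_cluster_iff] at hw
  obtain ⟨p⟩ := hw
  have key := Current.reachable_of_forall_adj_imp (ω := Current.traced (Function.update (M + k) b 0))
    (ω' := Current.traced (Function.update M b 0)) (B := B) (fun u y hu hadj => ?_) p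
    (hB ▸ mem_clusterOff_self M b v)
  · exact key.2
  -- one step from `u ∈ B`: the bond is not `b` and carries current of `M + k`; it cannot be a
  -- bond of `k` (those are off `B`), so it carries current of `M` and `y ∈ B`
  rw [openGraph_traced_update_adj_iff] at hadj
  obtain ⟨hG, hne, hpos⟩ := hadj
  have hk0 : k ⟨s(u, y), hG⟩ = 0 := by
    by_contra hk0
    exact (Current.isSupp_offGraph_iff' B k).1 hk ⟨s(u, y), hG⟩ hk0 u (Sym2.mem_mk_left u y) hu
  simp only [Pi.add_apply, hk0, add_zero] at hpos
  have hadjM : (Percolation.openGraph (Current.traced (Function.update M b 0))).Adj u y :=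
    (openGraph_traced_update_adj_iff M b u y).2 ⟨hG, hne, hpos⟩
  exact ⟨hadjM, hB ▸ mem_clusterOff_of_adj (hB.symm ▸ hu) hadjM⟩

/-- **Restricting to the bonds meeting `𝒞^b_N(v)` does not change `𝒞^b(v)`**: a walk from `v` in
`N ∖ b` stays in the cluster, so each of its bonds meets it. [cite: Sakai2007, (2.14) and (2.32)–(2.33)] -/
theorem clusterOff_spliceOff_eq {N : Current G} {b : G.edgeFinset} {v : V} {B : Finset V}
    (hB : clusterOff G N b v = B) : clusterOff G (Current.spliceOff B N 0) b v = B := by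
  refine Finset.Subset.antisymm ((clusterOff_mono (fun e => ?_) b v).trans (Finset.subset_of_eq hB)) ?_
  · by_cases he : Current.EdgeOff B (e : Sym2 V)
    · rw [Current.spliceOff_apply_of_edgeOff _ _ he]; exact Nat.zero_le _
    · rw [Current.spliceOff_apply_of_not_edgeOff _ _ he]
  intro w hw
  rw [← hB, clusterOff_eq, Current.mem_cluster_iff] at hw
  obtain ⟨p⟩ := hw
  have key := Current.reachable_of_forall_adj_imp (ω := Current.traced (Function.update N b 0))
    (ω' := Current.traced (Function.update (Current.spliceOff B N 0) b 0)) (B := B)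
    (fun u y hu hadj => ?_) p (hB ▸ mem_clusterOff_self N b v)
  · rw [clusterOff_eq, Current.mem_cluster_iff]
    exact key.1
  have hy : y ∈ B := hB ▸ mem_clusterOff_of_adj (hB.symm ▸ hu) hadj
  rw [openGraph_traced_update_adj_iff] at hadj
  obtain ⟨hG, hne, hpos⟩ := hadj
  refine ⟨(openGraph_traced_update_adj_iff _ b u y).2 ⟨hG, hne, ?_⟩, hy⟩
  have hnot : ¬Current.EdgeOff B (s(u, y) : Sym2 V) := fun h => (Current.edgeOff_mk.1 h).1 hu
  rw [Current.spliceOff_apply_of_not_edgeOff _ _ hnot]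
  exact hpos

/-! ## The decoupling identity across `𝒞^b(v)` for pairs of currents -/


/-- **Conditioning on `𝒞^b_n(v) = ℬ` for a single current** (the first stage, (2.14):
"Conditioning on `𝒞^b_n(o) = 𝒜` … using the notation `k = n|_{𝔹_Λ ∖ 𝔹_{𝒜ᶜ}}` and `m = n|_{𝔹_{𝒜ᶜ}}`"):
for `β ≥ 0`, a bond `b`, a vertex `v` and every `F ≥ 0`,
`Σ_n w(n) F(n) = Σ_ℬ Σ_{(k,m)} 1{k meets ℬ, 𝒞^b_k(v) = ℬ} 1{m ⊆ 𝔹_{ℬᶜ}} w(k) w(m) F(k + m)`.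
[cite: Sakai2007, (2.13)–(2.14)] -/
theorem tsum_eq_sum_clusterOff {β : ℝ} (hβ : 0 ≤ β) (b : G.edgeFinset) (v : V)
    (F : Current G → ℝ≥0∞) :
    ∑' n : Current G, ENNReal.ofReal (n.weight β) * F n =
      ∑ B : Finset V, ∑' q : Current G × Current G,
        (if Current.IsTouchSupp B q.1 ∧ clusterOff G q.1 b v = B
          then ENNReal.ofReal (q.1.weight β) else 0) *
        (if Current.IsSupp (offGraph G B) q.2 then ENNReal.ofReal (q.2.weight β) else 0) *
        F (q.1 + q.2) := by
  classical
  have hWmul : ∀ {S : Finset V} {a k : Current G}, Current.IsTouchSupp S a →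
      Current.IsSupp (offGraph G S) k →
        ENNReal.ofReal ((a + k).weight β) = ENNReal.ofReal (a.weight β) * ENNReal.ofReal (k.weight β) := by
    intro S a k ha hk
    rw [Current.weight_add_of_isTouchSupp ha hk β, ENNReal.ofReal_mul (Current.weight_nonneg hβ a)]
  -- Step 1: insert `1 = Σ_B 1{𝒞^b(v) = B}` and exchange the sums
  set f : Finset V → Current G → ℝ≥0∞ := fun B n =>
    if clusterOff G n b v = B then ENNReal.ofReal (n.weight β) * F n else 0 with hf_def
  have h1 : ∀ n : Current G, ENNReal.ofReal (n.weight β) * F n = ∑ B : Finset V, f B n := by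
    intro n
    simp only [hf_def]
    rw [Finset.sum_ite_eq Finset.univ (clusterOff G n b v), if_pos (Finset.mem_univ _)]
  simp_rw [h1]
  rw [Summable.tsum_finsetSum (fun B _ => ENNReal.summable)]
  refine Finset.sum_congr rfl fun B _ => ?_
  -- Step 2: for fixed `B`, reindex by `(k, m) ↦ k + m`
  set g : Current G × Current G → ℝ≥0∞ := fun q =>
    (if Current.IsTouchSupp B q.1 ∧ clusterOff G q.1 b v = B then ENNReal.ofReal (q.1.weight β) else 0) *
      (if Current.IsSupp (offGraph G B) q.2 then ENNReal.ofReal (q.2.weight β) else 0) *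
      F (q.1 + q.2) with hg_def
  change ∑' n, f B n = ∑' q, g q
  have hsupp : ∀ q, g q ≠ 0 →
      (Current.IsTouchSupp B q.1 ∧ clusterOff G q.1 b v = B) ∧ Current.IsSupp (offGraph G B) q.2 := by
    intro q hq
    simp only [hg_def] at hq
    by_cases hin : Current.IsTouchSupp B q.1 ∧ clusterOff G q.1 b v = B
    · by_cases hout : Current.IsSupp (offGraph G B) q.2
      · exact ⟨hin, hout⟩
      · rw [if_neg hout] at hq; simp at hq
    · rw [if_neg hin] at hq; simp at hq
  have hgval : ∀ q, g q ≠ 0 →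
      g q = ENNReal.ofReal (q.1.weight β) * ENNReal.ofReal (q.2.weight β) * F (q.1 + q.2) := by
    intro q hq
    obtain ⟨hin, hout⟩ := hsupp q hq
    simp only [hg_def, if_pos hin, if_pos hout]
  set i : Function.support g → Current G := fun q => q.1.1 + q.1.2 with hi_def
  refine tsum_eq_tsum_of_ne_zero_bij i ?_ ?_ ?_
  · rintro ⟨q, hq⟩ ⟨q', hq'⟩ h
    obtain ⟨⟨hq1, -⟩, hq2⟩ := hsupp q hq
    obtain ⟨⟨hq1', -⟩, hq2'⟩ := hsupp q' hq'
    simp only [hi_def] at h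
    have e1 : q.1 = q'.1 := by
      rw [← Current.spliceOff_add_zero_of_isTouchSupp hq1 hq2, h,
        Current.spliceOff_add_zero_of_isTouchSupp hq1' hq2']
    have e2 : q.2 = q'.2 := by
      rw [← Current.zero_spliceOff_add_of_isTouchSupp hq1 hq2, h,
        Current.zero_spliceOff_add_of_isTouchSupp hq1' hq2']
    exact Subtype.ext (Prod.ext e1 e2)
  · intro n hn
    rw [Function.mem_support] at hn
    simp only [hf_def] at hn
    by_cases hC : clusterOff G n b v = B
    swap
    · rw [if_neg hC] at hn; exact absurd rfl hn
    rw [if_pos hC] at hn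
    set a := Current.spliceOff B n 0
    set k := Current.spliceOff B 0 n
    have ha : Current.IsTouchSupp B a := Current.isTouchSupp_spliceOff_zero _ _
    have hk : Current.IsSupp (offGraph G B) k := Current.isSupp_offGraph_zero_spliceOff _ _
    have hn' : n = a + k := (Current.spliceOff_zero_add_zero_spliceOff B n).symm
    have hcl : clusterOff G a b v = B := clusterOff_spliceOff_eq hC
    set q : Current G × Current G := (a, k) with hq
    have hgq : g q = ENNReal.ofReal (n.weight β) * F n :=
      calc g q = ENNReal.ofReal (a.weight β) * ENNReal.ofReal (k.weight β) * F (a + k) := by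
            simp only [hg_def, hq, if_pos (And.intro ha hcl), if_pos hk]
        _ = ENNReal.ofReal ((a + k).weight β) * F (a + k) := by rw [hWmul ha hk]
        _ = ENNReal.ofReal (n.weight β) * F n := by rw [← hn']
    have hgq0 : g q ≠ 0 := by rw [hgq]; exact hn
    refine ⟨⟨q, hgq0⟩, ?_⟩
    simp only [hi_def, hq]
    exact hn'.symm
  · rintro ⟨q, hq⟩
    obtain ⟨⟨hq1, hcl⟩, hq2⟩ := hsupp q hq
    rw [hgval q hq]
    simp only [hi_def, hf_def]
    rw [if_pos (clusterOff_add_eq_of_isSupp hcl hq2), hWmul hq1 hq2]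

/-- **Conditioning on `𝒞^b_{m+n}(v) = ℬ` and decoupling** (the mechanism of Sakai 2007, (2.14) and
(2.32)–(2.33)): for `β ≥ 0`, a bond `b`, a vertex `v` and every `Φ ≥ 0` on pairs of currents,
`Σ_{(m,n)} w(m)w(n) Φ(m,n) = Σ_ℬ Σ_{((m',n'),(m'',n''))} 1{m', n' meet ℬ, 𝒞^b_{m'+n'}(v) = ℬ}
 1{m'', n'' ⊆ 𝔹_{ℬᶜ}} w(m')w(n')w(m'')w(n'') Φ(m'+m'', n'+n'')`: the map
`((m',n'),(m'',n'')) ↦ (m'+m'', n'+n'')` is a weight-preserving bijection onto the pairs with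
`𝒞^b_{m+n}(v) = ℬ`, with inverse the splitting along the bonds meeting / off `ℬ`.
[cite: Sakai2007, (2.14) and (2.32)–(2.33)] -/
theorem tsum_pair_eq_sum_clusterOff {β : ℝ} (hβ : 0 ≤ β) (b : G.edgeFinset) (v : V)
    (Φ : Current G × Current G → ℝ≥0∞) :
    ∑' p : Current G × Current G,
        ENNReal.ofReal (p.1.weight β) * ENNReal.ofReal (p.2.weight β) * Φ p =
      ∑ B : Finset V, ∑' q : (Current G × Current G) × (Current G × Current G),
        (if Current.IsTouchSupp B q.1.1 ∧ Current.IsTouchSupp B q.1.2 ∧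
            clusterOff G (q.1.1 + q.1.2) b v = B
          then ENNReal.ofReal (q.1.1.weight β) * ENNReal.ofReal (q.1.2.weight β) else 0) *
        (if Current.IsSupp (offGraph G B) q.2.1 ∧ Current.IsSupp (offGraph G B) q.2.2
          then ENNReal.ofReal (q.2.1.weight β) * ENNReal.ofReal (q.2.2.weight β) else 0) *
        Φ (q.1.1 + q.2.1, q.1.2 + q.2.2) := by
  classical
  -- the weights factorise across the splitting
  have hWmul : ∀ {S : Finset V} {a k : Current G}, Current.IsTouchSupp S a →
      Current.IsSupp (offGraph G S) k →
        ENNReal.ofReal ((a + k).weight β) = ENNReal.ofReal (a.weight β) * ENNReal.ofReal (k.weight β) := by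
    intro S a k ha hk
    rw [Current.weight_add_of_isTouchSupp ha hk β, ENNReal.ofReal_mul (Current.weight_nonneg hβ a)]
  -- Step 1: insert `1 = Σ_B 1{𝒞^b(v) = B}` and exchange the sums
  set f : Finset V → Current G × Current G → ℝ≥0∞ := fun B p =>
    if clusterOff G (p.1 + p.2) b v = B then
      ENNReal.ofReal (p.1.weight β) * ENNReal.ofReal (p.2.weight β) * Φ p else 0 with hf_def
  have h1 : ∀ p : Current G × Current G,
      ENNReal.ofReal (p.1.weight β) * ENNReal.ofReal (p.2.weight β) * Φ p = ∑ B : Finset V, f B p := by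
    intro p
    simp only [hf_def]
    rw [Finset.sum_ite_eq Finset.univ (clusterOff G (p.1 + p.2) b v), if_pos (Finset.mem_univ _)]
  simp_rw [h1]
  rw [Summable.tsum_finsetSum (fun B _ => ENNReal.summable)]
  refine Finset.sum_congr rfl fun B _ => ?_
  -- Step 2: for fixed `B`, reindex by `(a, k) ↦ a + k`
  set g : (Current G × Current G) × (Current G × Current G) → ℝ≥0∞ := fun q =>
    (if Current.IsTouchSupp B q.1.1 ∧ Current.IsTouchSupp B q.1.2 ∧
        clusterOff G (q.1.1 + q.1.2) b v = B
      then ENNReal.ofReal (q.1.1.weight β) * ENNReal.ofReal (q.1.2.weight β) else 0) *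
      (if Current.IsSupp (offGraph G B) q.2.1 ∧ Current.IsSupp (offGraph G B) q.2.2
        then ENNReal.ofReal (q.2.1.weight β) * ENNReal.ofReal (q.2.2.weight β) else 0) *
      Φ (q.1.1 + q.2.1, q.1.2 + q.2.2) with hg_def
  change ∑' p, f B p = ∑' q, g q
  have hsupp : ∀ q, g q ≠ 0 → (Current.IsTouchSupp B q.1.1 ∧ Current.IsTouchSupp B q.1.2 ∧
      clusterOff G (q.1.1 + q.1.2) b v = B) ∧
      (Current.IsSupp (offGraph G B) q.2.1 ∧ Current.IsSupp (offGraph G B) q.2.2) := by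
    intro q hq
    simp only [hg_def] at hq
    by_cases hin : Current.IsTouchSupp B q.1.1 ∧ Current.IsTouchSupp B q.1.2 ∧
        clusterOff G (q.1.1 + q.1.2) b v = B
    · by_cases hout : Current.IsSupp (offGraph G B) q.2.1 ∧ Current.IsSupp (offGraph G B) q.2.2
      · exact ⟨hin, hout⟩
      · rw [if_neg hout] at hq; simp at hq
    · rw [if_neg hin] at hq; simp at hq
  have hgval : ∀ q, g q ≠ 0 → g q = ENNReal.ofReal (q.1.1.weight β) * ENNReal.ofReal (q.1.2.weight β) *
      (ENNReal.ofReal (q.2.1.weight β) * ENNReal.ofReal (q.2.2.weight β)) *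
      Φ (q.1.1 + q.2.1, q.1.2 + q.2.2) := by
    intro q hq
    obtain ⟨hin, hout⟩ := hsupp q hq
    simp only [hg_def, if_pos hin, if_pos hout]
  set i : Function.support g → Current G × Current G := fun q =>
    (q.1.1.1 + q.1.2.1, q.1.1.2 + q.1.2.2) with hi_def
  refine tsum_eq_tsum_of_ne_zero_bij i ?_ ?_ ?_
  · -- injectivity: the parts are recovered by splicing
    rintro ⟨q, hq⟩ ⟨q', hq'⟩ h
    obtain ⟨⟨hq11, hq12, -⟩, hq21, hq22⟩ := hsupp q hq
    obtain ⟨⟨hq11', hq12', -⟩, hq21', hq22'⟩ := hsupp q' hq'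
    simp only [hi_def, Prod.mk.injEq] at h
    obtain ⟨ha, hb⟩ := h
    have e11 : q.1.1 = q'.1.1 := by
      rw [← Current.spliceOff_add_zero_of_isTouchSupp hq11 hq21, ha,
        Current.spliceOff_add_zero_of_isTouchSupp hq11' hq21']
    have e21 : q.2.1 = q'.2.1 := by
      rw [← Current.zero_spliceOff_add_of_isTouchSupp hq11 hq21, ha,
        Current.zero_spliceOff_add_of_isTouchSupp hq11' hq21']
    have e12 : q.1.2 = q'.1.2 := by
      rw [← Current.spliceOff_add_zero_of_isTouchSupp hq12 hq22, hb,
        Current.spliceOff_add_zero_of_isTouchSupp hq12' hq22']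
    have e22 : q.2.2 = q'.2.2 := by
      rw [← Current.zero_spliceOff_add_of_isTouchSupp hq12 hq22, hb,
        Current.zero_spliceOff_add_of_isTouchSupp hq12' hq22']
    exact Subtype.ext (Prod.ext (Prod.ext e11 e12) (Prod.ext e21 e22))
  · -- the range covers the support of `f B`
    intro p hp
    rw [Function.mem_support] at hp
    simp only [hf_def] at hp
    by_cases hC : clusterOff G (p.1 + p.2) b v = B
    swap
    · rw [if_neg hC] at hp; exact absurd rfl hp
    rw [if_pos hC] at hp
    set a₁ := Current.spliceOff B p.1 0
    set a₂ := Current.spliceOff B p.2 0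
    set k₁ := Current.spliceOff B 0 p.1
    set k₂ := Current.spliceOff B 0 p.2
    have ha₁ : Current.IsTouchSupp B a₁ := Current.isTouchSupp_spliceOff_zero _ _
    have ha₂ : Current.IsTouchSupp B a₂ := Current.isTouchSupp_spliceOff_zero _ _
    have hk₁ : Current.IsSupp (offGraph G B) k₁ := Current.isSupp_offGraph_zero_spliceOff _ _
    have hk₂ : Current.IsSupp (offGraph G B) k₂ := Current.isSupp_offGraph_zero_spliceOff _ _
    have hp1 : p.1 = a₁ + k₁ := (Current.spliceOff_zero_add_zero_spliceOff B p.1).symm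
    have hp2 : p.2 = a₂ + k₂ := (Current.spliceOff_zero_add_zero_spliceOff B p.2).symm
    have hcl : clusterOff G (a₁ + a₂) b v = B := by
      have : a₁ + a₂ = Current.spliceOff B (p.1 + p.2) 0 := by
        rw [← add_zero (0 : Current G), Current.spliceOff_add_add]
      rw [this]
      exact clusterOff_spliceOff_eq hC
    set q : (Current G × Current G) × (Current G × Current G) := ((a₁, a₂), (k₁, k₂)) with hq
    have hgq : g q = ENNReal.ofReal (p.1.weight β) * ENNReal.ofReal (p.2.weight β) * Φ p :=
      calc g q = ENNReal.ofReal (a₁.weight β) * ENNReal.ofReal (a₂.weight β) *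
            (ENNReal.ofReal (k₁.weight β) * ENNReal.ofReal (k₂.weight β)) * Φ (a₁ + k₁, a₂ + k₂) := by
            simp only [hg_def, hq, if_pos (And.intro ha₁ (And.intro ha₂ hcl)), if_pos (And.intro hk₁ hk₂)]
        _ = ENNReal.ofReal ((a₁ + k₁).weight β) * ENNReal.ofReal ((a₂ + k₂).weight β) *
            Φ (a₁ + k₁, a₂ + k₂) := by
            rw [hWmul ha₁ hk₁, hWmul ha₂ hk₂]; ring
        _ = ENNReal.ofReal (p.1.weight β) * ENNReal.ofReal (p.2.weight β) * Φ p := by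
            rw [← hp1, ← hp2]
    have hgq0 : g q ≠ 0 := by rw [hgq]; exact hp
    refine ⟨⟨q, hgq0⟩, ?_⟩
    simp only [hi_def, hq]
    rw [← hp1, ← hp2]
  · -- values agree
    rintro ⟨q, hq⟩
    obtain ⟨⟨hq11, hq12, hcl⟩, hq21, hq22⟩ := hsupp q hq
    rw [hgval q hq]
    simp only [hi_def, hf_def]
    have hsum : q.1.1 + q.2.1 + (q.1.2 + q.2.2) = (q.1.1 + q.1.2) + (q.2.1 + q.2.2) := by abel
    have hcl' : clusterOff G (q.1.1 + q.2.1 + (q.1.2 + q.2.2)) b v = B := by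
      rw [hsum]
      exact clusterOff_add_eq_of_isSupp hcl (Current.isSupp_add hq21 hq22)
    rw [if_pos hcl', hWmul hq11 hq21, hWmul hq12 hq22]
    ring

end IsingLace

end Literature.Probability.LatticeModels

end
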